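import Literature.AlgebraicGeometry.Pohlmann1968.SeparatingCMFamilies
import Literature.AlgebraicGeometry.ComplexMultiplication.QuarticCMTypeReflectionConjugationSquare
import Literature.AlgebraicGeometry.ComplexMultiplication.ImaginaryQuadraticTimesQuarticCMHodge
import Literature.AlgebraicGeometry.ComplexMultiplication.QuarticCMReflexPairSimpleSurfacePairsHodge
import HarnessLib

/-!
# Pairs of quartic CM fields, II: any two simple, non-isogenous CM abelian surfaces form a nondegenerate pair
# (`Hg(S₀ × S₁) = Hg(S₀) × Hg(S₁)`, rank `5`; Moonen–Zarhin 1999, "Hodge groups of simple abelian surfaces of CM-type")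

(Part 1) The fixed-point case of the two-quartic-slot combinatorics; isomorphic NON-GALOIS quartic CM fields with a separating
pair of types (no CM-equivalence of the two surfaces) give a nondegenerate family
(`isNondegenerateFamily_of_ringEquiv_of_isSeparatingFamily`), whence two simple non-isogenous CM surfaces with `K_{i₀}`
non-Galois form a nondegenerate pair (`isNondegenerateFamily_simpleSurfaces_of_not_isGalois`). (Part 2) In a cyclic group of
order `4` the elements of square `1` are `1, ρ` and every other element squares to `ρ`; isomorphic CYCLIC quartic CM fields
carry no separating pair of CM types (two simple CM surfaces with isomorphic cyclic quartic CM fields are isogenous,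
`false_of_isCyclic_of_ringEquiv_of_isSeparatingFamily`); assembling the cases (different closures: `QuarticCMReflexPair…`
Part 2 and the real-intersection criterion; same closure: Part 1 of that file; isomorphic fields: above): **any two simple,
non-isogenous CM abelian surfaces `S₀, S₁` — realisations of separating CM types of quartic CM fields — form a NONDEGENERATE
pair** (`isNondegenerateFamily_simpleSurfaces`), i.e. no product `S₀^a × S₁^b` carries an exotic Hodge class.

* Part 1 — from `CorCM/NonIsogenousSimpleCMSurfacesHodge` (7/8 declarations; namespace
  `Literature.AlgebraicGeometry.ComplexMultiplication`): Any two simple non-isogenous CM abelian surfaces (one CM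
  field non-Galois, or the fields non-isomorphic): the Hodge. Declarations: `sum_eq_add_two'`,
  `isNondegenerateFamily_pair_of_reflection_fixed`, `smul_eq_smul_of_forall_smul_eq'`, `smul_comp`, `conjugate_comp`,
  `isNondegenerateFamily_of_ringEquiv_of_isSeparatingFamily`, `isNondegenerateFamily_simpleSurfaces_of_not_isGalois`.
* Part 2 — from `CorCM/TwoSimpleCMSurfacesHodge` (6/8 declarations; namespace
  `Literature.AlgebraicGeometry.ComplexMultiplication`): ANY two simple, non-isogenous CM abelian surfaces: the pair
  is nondegenerate, and the Hodge conjecture holds on every. Declarations: `eq_one_or_eq_of_mul_self_eq_one`,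
  `mul_self_eq_of_ne`, `conjugate_comp'`, `false_of_pullback`, `false_of_isCyclic_of_ringEquiv_of_isSeparatingFamily`,
  `isNondegenerateFamily_simpleSurfaces`.

## References

* [MoonenZarhin1999LowDim] B. Moonen, Yu. Zarhin, Math. Ann. 315 (1999), "Hodge groups of simple abelian surfaces of
  CM-type" and Cor. (3.9).
* [Shimura1998] G. Shimura, *Abelian Varieties with Complex Multiplication and Modular Functions*, §8.4 Example
  (2)(C).
* [Gordon1999HodgeAVSurvey] B. B. Gordon, *A survey of the Hodge conjecture for abelian varieties*, 7.4–7.5, §9.2–9.3,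
  10.10.

Provenance: Literature home of the used declarations of the Summits-side modules listed part by part above (cells
`pub-hodge-ring2` / `pub-hodgecm2`; namespaces `Summit.HodgeConjecture.CorCM` re-rooted under
`Literature.AlgebraicGeometry.…` as stated), whose imports are `Literature/` and Mathlib only for the declarations
used; re-homed verbatim (proofs unchanged) so that Literature users are served without importing `Summits/`. Lane
`lit-hodgefound`, seat p20 (generation 34). Theorems only: no definition, no named fact, no `sorry`; axioms `propext`,
`Classical.choice`, `Quot.sound`.
-/

/-! ## Part 1: NonIsogenousSimpleCMSurfacesHodge -/

noncomputable section

open _root_.CategoryTheory _root_.CategoryTheory.Limits NumberField NumberField.ComplexEmbedding IntermediateField Module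

namespace Literature.AlgebraicGeometry.ComplexMultiplication

open Literature.AlgebraicGeometry.ComplexMultiplication.Domination Literature.AlgebraicGeometry.ComplexMultiplication.RealIntersectionCMFieldsHodge

open Literature.NumberTheory.ComplexMultiplication
open Literature.NumberTheory.ComplexMultiplication.CMTypeOps (mem_iff_conjugate_notMem mem_or_conjugate_mem)
open Literature.AlgebraicGeometry.Motives (AbelianVariety CMType)
open Literature.AlgebraicGeometry.HodgeTheory
open Literature.AlgebraicGeometry.ComplexMultiplication (IsCMTypeRealisation isSimple_iff_isPrimitive)
open Literature.AlgebraicGeometry.Pohlmann1968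

section Core

variable {I : Type} {K : I → Type} [∀ i, Field (K i)] [∀ i, NumberField (K i)] [∀ i, IsCMField (K i)] [Fintype I]

omit [∀ i, NumberField (K i)] [∀ i, IsCMField (K i)] [Fintype I] in
/-- `Σ_i G(i) = G(i₀) + G(i₁)` on a two-slot index type. [cite: MoonenZarhin1999LowDim, "Hodge groups of simple abelian surfaces of CM-type"] -/
private theorem sum_eq_add_two' {M : Type*} [AddCommMonoid M] [Fintype I] {i₀ i₁ : I} (h01 : i₀ ≠ i₁)
    (hI : ∀ j, j = i₀ ∨ j = i₁) (G : I → M) : ∑ i, G i = G i₀ + G i₁ := by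
  classical
  have huniv : (Finset.univ : Finset I) = {i₀, i₁} := by
    ext j
    simpa using hI j
  rw [huniv, Finset.sum_pair h01]

/-- **The combinatorial core, fixed-point case**: two quartic slots; `τ` a `4`-cycle `a ↦ b ↦ ā ↦ b̄` and `τ₀` the
reflection fixing `a, ā` on the first; `τ²c = c̄`, `τ₀τc = τ³τ₀c` and `τ₀c = c` on the second; types `{a, b}` and
`{c, τ̄c}` (the "flipped" partner): the eight balance identities force conjugation-invariance.
[cite: MoonenZarhin1999LowDim, "Hodge groups of simple abelian surfaces of CM-type"] [cite: Gordon1999HodgeAVSurvey, §9.2–9.3] -/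
theorem isNondegenerateFamily_pair_of_reflection_fixed {i₀ i₁ : I} (h01 : i₀ ≠ i₁) (hI : ∀ j, j = i₀ ∨ j = i₁)
    (h4₀ : finrank ℚ (K i₀) = 4) (h4₁ : finrank ℚ (K i₁) = 4) {a b : K i₀ →+* ℂ} (hba : b ≠ a)
    (hba' : b ≠ conjugate a) {c : K i₁ →+* ℂ} {τ τ₀ : ℂ ≃+* ℂ} (hτa : τ • a = b) (hτb : τ • b = conjugate a)
    (hτ₀a : τ₀ • a = a) (hτ₀b : τ₀ • b = conjugate b) (hτc : τ • τ • c = conjugate c)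
    (hτ₀τc : τ₀ • τ • c = τ • τ • τ • τ₀ • c) (hτ₀c : τ₀ • c = c)
    {Φ : ∀ i, CMType (K i)} (hΦ₀ : ∀ s, s ∈ (Φ i₀).1 ↔ s = a ∨ s = b)
    (hΦ₁ : ∀ s, s ∈ (Φ i₁).1 ↔ s = c ∨ s = conjugate (τ • c)) : CMAlgebra.IsNondegenerateFamily Φ := by
  classical
  haveI : Nonempty I := ⟨i₀⟩
  have hτa' : τ • conjugate a = conjugate b := by rw [QuarticCM.smul_conjugate, hτa]
  have hτb' : τ • conjugate b = a := by rw [QuarticCM.smul_conjugate, hτb, involutive_conjugate (K i₀) a]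
  have hτ₀a' : τ₀ • conjugate a = conjugate a := by rw [QuarticCM.smul_conjugate, hτ₀a]
  have hτ₀b' : τ₀ • conjugate b = b := by rw [QuarticCM.smul_conjugate, hτ₀b, involutive_conjugate (K i₀) b]
  have hΦa : a ∈ (Φ i₀).1 := (hΦ₀ a).2 (Or.inl rfl); have hΦb : b ∈ (Φ i₀).1 := (hΦ₀ b).2 (Or.inr rfl)
  have hΦna : conjugate a ∉ (Φ i₀).1 := (mem_iff_conjugate_notMem (Φ i₀) a).1 hΦa
  have hΦnb : conjugate b ∉ (Φ i₀).1 := (mem_iff_conjugate_notMem (Φ i₀) b).1 hΦb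
  -- second slot: `d = τc`, `τ d = c̄`, `τ c̄ = d̄`, `τ d̄ = c`; `τ₀`: `c, c̄` fixed, `d ↔ d̄`
  set d : K i₁ →+* ℂ := τ • c with hd
  have hτd : τ • d = conjugate c := hτc
  have hτc' : τ • conjugate c = conjugate d := by rw [QuarticCM.smul_conjugate]
  have hτd' : τ • conjugate d = c := by rw [QuarticCM.smul_conjugate, hτd, involutive_conjugate (K i₁) c]
  have hdc : d ≠ c := by
    intro h
    have h2 : τ • τ • c = c := by rw [← hd, h, ← hd, h]
    exact QuarticCM.conjugate_ne c (hτc.symm.trans h2)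
  have hdc' : d ≠ conjugate c := by
    intro h
    have h1 : τ • conjugate c = conjugate c := by rwa [h] at hτd
    have h2 : τ • c = c := by
      have := congrArg conjugate h1
      rwa [QuarticCM.smul_conjugate, involutive_conjugate (K i₁) (τ • c), involutive_conjugate (K i₁) c] at this
    exact hdc (hd.trans h2)
  have hτ₀c' : τ₀ • conjugate c = conjugate c := by rw [QuarticCM.smul_conjugate, hτ₀c]
  have hτ₀d : τ₀ • d = conjugate d := by rw [hd, hτ₀τc, hτ₀c, hτc, hτc']
  have hτ₀d' : τ₀ • conjugate d = d := by rw [QuarticCM.smul_conjugate, hτ₀d, involutive_conjugate (K i₁) d]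
  have hΦc : c ∈ (Φ i₁).1 := (hΦ₁ c).2 (Or.inl rfl)
  have hΦd' : conjugate d ∈ (Φ i₁).1 := (hΦ₁ (conjugate d)).2 (Or.inr rfl)
  have hΦnc : conjugate c ∉ (Φ i₁).1 := (mem_iff_conjugate_notMem (Φ i₁) c).1 hΦc
  have hΦnd : d ∉ (Φ i₁).1 := fun h => (mem_iff_conjugate_notMem (Φ i₁) d).1 h hΦd'
  rw [CMAlgebra.isNondegenerateFamily_iff_forall_nat_symm]
  intro f hf
  have hsum : ∀ g : ℂ ≃+* ℂ,
      ∑ x : (i : I) × (K i →+* ℂ), (f x : ℚ) * translateInd (CMAlgebra.familyType Φ) g x =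
        (f ⟨i₀, a⟩ : ℚ) * translateInd (Φ i₀).1 g a + f ⟨i₀, conjugate a⟩ * translateInd (Φ i₀).1 g (conjugate a) +
          f ⟨i₀, b⟩ * translateInd (Φ i₀).1 g b + f ⟨i₀, conjugate b⟩ * translateInd (Φ i₀).1 g (conjugate b) +
        ((f ⟨i₁, c⟩ : ℚ) * translateInd (Φ i₁).1 g c + f ⟨i₁, conjugate c⟩ * translateInd (Φ i₁).1 g (conjugate c) +
          f ⟨i₁, d⟩ * translateInd (Φ i₁).1 g d + f ⟨i₁, conjugate d⟩ * translateInd (Φ i₁).1 g (conjugate d)) :=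
    fun g => by
    rw [Fintype.sum_sigma, sum_eq_add_two' h01 hI, QuarticCM.sum_eq_add_four h4₀ hba hba',
      QuarticCM.sum_eq_add_four h4₁ hdc hdc']
    simp only [CMAlgebra.translateInd_familyType]
  have htot : ∑ x : (i : I) × (K i →+* ℂ), (f x : ℚ) =
      (f ⟨i₀, a⟩ : ℚ) + f ⟨i₀, conjugate a⟩ + f ⟨i₀, b⟩ + f ⟨i₀, conjugate b⟩ +
        ((f ⟨i₁, c⟩ : ℚ) + f ⟨i₁, conjugate c⟩ + f ⟨i₁, d⟩ + f ⟨i₁, conjugate d⟩) := by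
    rw [Fintype.sum_sigma, sum_eq_add_two' h01 hI, QuarticCM.sum_eq_add_four h4₀ hba hba',
      QuarticCM.sum_eq_add_four h4₁ hdc hdc']
  have E1 := hf 1; have E2 := hf τ; have E3 := hf (τ * τ); have E4 := hf (τ * τ * τ)
  have E5 := hf τ₀; have E6 := hf (τ₀ * τ); have E7 := hf (τ₀ * (τ * τ)); have E8 := hf (τ₀ * (τ * τ * τ))
  rw [hsum, htot] at E1 E2 E3 E4 E5 E6 E7 E8
  simp only [translateInd, one_smul, mul_smul, hτa, hτa', hτb, hτb', hτ₀a, hτ₀a', hτ₀b, hτ₀b', ← hd, hτd, hτc',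
    hτd', hτ₀c, hτ₀c', hτ₀d, hτ₀d', hΦa, hΦb, hΦna, hΦnb, hΦc, hΦd', hΦnc, hΦnd,
    if_true, if_false, mul_one, mul_zero, add_zero, zero_add] at E1 E2 E3 E4 E5 E6 E7 E8
  have kc : (f ⟨i₁, conjugate c⟩ : ℚ) = f ⟨i₁, c⟩ := by linarith
  have kd : (f ⟨i₁, conjugate d⟩ : ℚ) = f ⟨i₁, d⟩ := by linarith
  have ka : (f ⟨i₀, conjugate a⟩ : ℚ) = f ⟨i₀, a⟩ := by linarith
  have kb : (f ⟨i₀, conjugate b⟩ : ℚ) = f ⟨i₀, b⟩ := by linarith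
  rintro ⟨i, s⟩
  change f ⟨i, conjugate s⟩ = f ⟨i, s⟩
  rcases hI i with rfl | rfl
  · rcases QuarticCM.eq_or_eq_or_eq_or_eq h4₀ hba hba' s with rfl | rfl | rfl | rfl
    · exact_mod_cast ka
    · rw [involutive_conjugate (K i) a]; exact_mod_cast ka.symm
    · exact_mod_cast kb
    · rw [involutive_conjugate (K i) b]; exact_mod_cast kb.symm
  · rcases QuarticCM.eq_or_eq_or_eq_or_eq h4₁ hdc hdc' s with rfl | rfl | rfl | rfl
    · exact_mod_cast kc
    · rw [involutive_conjugate (K i) c]; exact_mod_cast kc.symm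
    · exact_mod_cast kd
    · rw [involutive_conjugate (K i) d]; exact_mod_cast kd.symm

end Core

/-! ### Isomorphic fields: the separating pairs are the nondegenerate ones -/

section Dress

variable {I : Type} {K : I → Type} [∀ i, Field (K i)] [∀ i, NumberField (K i)] [∀ i, IsCMField (K i)] [Fintype I]

omit [∀ i, IsCMField (K i)] [Fintype I] in
/-- Two automorphisms of `ℂ` agreeing on every embedding of `K_{i₀}` agree on every embedding of a field `K_{i₁}` all
of whose embeddings take values in `L_{i₀}`. [cite: MoonenZarhin1999LowDim, "Hodge groups of simple abelian surfaces of CM-type"] -/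
private theorem smul_eq_smul_of_forall_smul_eq' {i₀ i₁ : I} {σ σ' : ℂ ≃+* ℂ}
    (h : ∀ s : K i₀ →+* ℂ, σ • s = σ' • s)
    (hL : ∀ (s' : K i₁ →+* ℂ) (x : K i₁), s' x ∈ normalClosure ℚ (K i₀) ℂ) (s' : K i₁ →+* ℂ) :
    σ • s' = σ' • s' :=
  RingHom.ext fun x => apply_eq_of_forall_smul_eq i₀ h (hL s' x)

omit [∀ i, NumberField (K i)] [∀ i, IsCMField (K i)] [Fintype I] in
/-- `(τ ∘ u) ∘ e = τ ∘ (u ∘ e)`. [cite: MoonenZarhin1999LowDim, "Hodge groups of simple abelian surfaces of CM-type"] -/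
private theorem smul_comp {i₀ i₁ : I} (τ : ℂ ≃+* ℂ) (u : K i₁ →+* ℂ) (e : K i₀ →+* K i₁) :
    (τ • u).comp e = τ • (u.comp e) := by
  rw [ringEquiv_smul_def, ringEquiv_smul_def, RingHom.comp_assoc]

omit [∀ i, NumberField (K i)] [Fintype I] in
/-- `ū ∘ e = \overline{u ∘ e}`. [cite: MoonenZarhin1999LowDim, "Hodge groups of simple abelian surfaces of CM-type"] -/
private theorem conjugate_comp {i₀ i₁ : I} (u : K i₁ →+* ℂ) (e : K i₀ →+* K i₁) :
    (conjugate u).comp e = conjugate (u.comp e) :=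
  RingHom.ext fun x => by rw [RingHom.comp_apply, conjugate_coe_eq, conjugate_coe_eq, RingHom.comp_apply]

/-- **Isomorphic fields, separating family ⟹ nondegenerate.**  `K_{i₀}` a non-Galois quartic CM field,
`e : K_{i₀} ≃ K_{i₁}`, `(Φ_{i₀}, Φ_{i₁})` a SEPARATING family (no CM-equivalence along any field isomorphism).  Then the
family is nondegenerate: with `c = a ∘ e⁻¹` (fixed by `τ₀`) the types `{c, τc}` and `{c̄, τ̄c}` are equivalent to
`Φ_{i₀}`, `Φ̄_{i₀}` along `e`, `ρe`, and the remaining two fall under the fixed-point core.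
[cite: MoonenZarhin1999LowDim, "Hodge groups of simple abelian surfaces of CM-type"] [cite: Shimura1998, §8.4 Example (2)(C)] -/
theorem isNondegenerateFamily_of_ringEquiv_of_isSeparatingFamily {i₀ i₁ : I} (h01 : i₀ ≠ i₁)
    (hI : ∀ j, j = i₀ ∨ j = i₁) (h4₀ : finrank ℚ (K i₀) = 4) (hK₀ : ¬ IsGalois ℚ (K i₀))
    (h4₁ : finrank ℚ (K i₁) = 4) (e : K i₀ ≃+* K i₁) {Φ : ∀ i, CMType (K i)}
    (hsep : CMAlgebra.IsSeparatingFamily Φ) : CMAlgebra.IsNondegenerateFamily Φ := by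
  -- slot `i₀`
  obtain ⟨a, b, hba, hba', hΦ₀⟩ := QuarticCM.exists_mem_mem_ne h4₀ (Φ i₀)
  obtain ⟨τ, hτa, hτb⟩ := QuarticCM.exists_ringAut_smul_eq_smul_eq_conjugate h4₀ hK₀ hba hba'
  obtain ⟨τ₀, hτ₀a, hτ₀b⟩ := QuarticCM.exists_ringAut_smul_eq_self_smul_eq_conjugate_of_not_isGalois h4₀ hK₀ hba hba'
  have hτa' : τ • conjugate a = conjugate b := by rw [QuarticCM.smul_conjugate, hτa]
  have hτb' : τ • conjugate b = a := by rw [QuarticCM.smul_conjugate, hτb, involutive_conjugate (K i₀) a]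
  have hτ₀a' : τ₀ • conjugate a = conjugate a := by rw [QuarticCM.smul_conjugate, hτ₀a]
  have hτ₀b' : τ₀ • conjugate b = b := by rw [QuarticCM.smul_conjugate, hτ₀b, involutive_conjugate (K i₀) b]
  have hΦa : a ∈ (Φ i₀).1 := (hΦ₀ a).2 (Or.inl rfl); have hΦb : b ∈ (Φ i₀).1 := (hΦ₀ b).2 (Or.inr rfl)
  have hΦna : conjugate a ∉ (Φ i₀).1 := (mem_iff_conjugate_notMem (Φ i₀) a).1 hΦa
  have hΦnb : conjugate b ∉ (Φ i₀).1 := (mem_iff_conjugate_notMem (Φ i₀) b).1 hΦb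
  have h1 : ∀ s : K i₀ →+* ℂ, (τ * τ) • s = (starRingAut : ℂ ≃+* ℂ) • s := by
    intro s
    rw [mul_smul, conj_smul_eq_conjugate]
    rcases QuarticCM.eq_or_eq_or_eq_or_eq h4₀ hba hba' s with rfl | rfl | rfl | rfl
    · rw [hτa, hτb]
    · rw [hτa', hτb', involutive_conjugate (K i₀) a]
    · rw [hτb, hτa']
    · rw [hτb', hτa, involutive_conjugate (K i₀) b]
  have h2 : ∀ s : K i₀ →+* ℂ, (τ₀ * τ) • s = (τ * τ * τ * τ₀) • s := by
    intro s
    simp only [mul_smul]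
    rcases QuarticCM.eq_or_eq_or_eq_or_eq h4₀ hba hba' s with rfl | rfl | rfl | rfl
    · rw [hτa, hτ₀b, hτ₀a, hτa, hτb, hτa']
    · rw [hτa', hτ₀b', hτ₀a', hτa', hτb', hτa]
    · rw [hτb, hτ₀a', hτ₀b, hτb', hτa, hτb]
    · rw [hτb', hτ₀a, hτ₀b', hτb, hτa', hτb']
  -- slot `i₁`: embeddings valued in `L₀`; `c = a ∘ e⁻¹` is fixed by `τ₀`
  have hL : ∀ (u : K i₁ →+* ℂ) (x : K i₁), u x ∈ normalClosure ℚ (K i₀) ℂ := fun u x => by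
    have h := apply_mem_normalClosure i₀ (u.comp e.toRingHom) (e.symm x)
    rwa [RingHom.comp_apply, RingEquiv.toRingHom_eq_coe, RingEquiv.coe_toRingHom, e.apply_symm_apply] at h
  have g1 : ∀ u : K i₁ →+* ℂ, τ • τ • u = conjugate u := fun u => by
    have h := smul_eq_smul_of_forall_smul_eq' h1 hL u
    rwa [mul_smul, conj_smul_eq_conjugate] at h
  have g2 : ∀ u : K i₁ →+* ℂ, τ₀ • τ • u = τ • τ • τ • τ₀ • u := fun u => by
    have h := smul_eq_smul_of_forall_smul_eq' h2 hL u
    simpa only [mul_smul] using h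
  set c : K i₁ →+* ℂ := a.comp e.symm.toRingHom with hc
  have hce : ∀ u : K i₁ →+* ℂ, u = (u.comp e.toRingHom).comp e.symm.toRingHom := fun u =>
    RingHom.ext fun x => by simp
  have hcea : c.comp e.toRingHom = a := RingHom.ext fun x => by simp [hc]
  have hτ₀c : τ₀ • c = c := by
    rw [hc, ← smul_comp, hτ₀a]
  have hτc : τ • τ • c = conjugate c := g1 c
  set d : K i₁ →+* ℂ := τ • c with hd
  have hdeb : d.comp e.toRingHom = b := by rw [hd, smul_comp, hcea, hτa]
  have hdc : d ≠ c := by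
    intro h
    have h2' : τ • τ • c = c := by rw [← hd, h, ← hd, h]
    exact QuarticCM.conjugate_ne c (hτc.symm.trans h2')
  have hdc' : d ≠ conjugate c := by
    intro h
    have h1' : τ • conjugate c = conjugate c := by
      have h0 : τ • d = conjugate c := hτc
      rwa [h] at h0
    have h2' : τ • c = c := by
      have := congrArg conjugate h1'
      rwa [QuarticCM.smul_conjugate, involutive_conjugate (K i₁) (τ • c), involutive_conjugate (K i₁) c] at this
    exact hdc (hd.trans h2')
  -- pulling a type of `K_{i₁}` back along an isomorphism
  have hpull : ∀ (e' : K i₀ ≃+* K i₁) (x y : K i₁ →+* ℂ), y ≠ x → y ≠ conjugate x →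
      (∀ s, s ∈ (Φ i₁).1 ↔ s = x ∨ s = y) → x.comp e'.toRingHom ∈ (Φ i₀).1 → y.comp e'.toRingHom ∈ (Φ i₀).1 →
      False := by
    intro e' x y hyx hyx' hΦ₁ hx hy
    refine h01 (hsep.eq_of_forall_mem_iff_comp_mem e' fun u => ?_)
    have hnx : (conjugate x).comp e'.toRingHom ∉ (Φ i₀).1 := by
      rw [conjugate_comp]; exact (mem_iff_conjugate_notMem (Φ i₀) _).1 hx
    have hny : (conjugate y).comp e'.toRingHom ∉ (Φ i₀).1 := by
      rw [conjugate_comp]; exact (mem_iff_conjugate_notMem (Φ i₀) _).1 hy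
    have hΦx : x ∈ (Φ i₁).1 := (hΦ₁ x).2 (Or.inl rfl)
    have hΦy : y ∈ (Φ i₁).1 := (hΦ₁ y).2 (Or.inr rfl)
    rcases QuarticCM.eq_or_eq_or_eq_or_eq h4₁ hyx hyx' u with rfl | rfl | rfl | rfl
    · exact iff_of_true hΦx hx
    · exact iff_of_false ((mem_iff_conjugate_notMem (Φ i₁) _).1 hΦx) hnx
    · exact iff_of_true hΦy hy
    · exact iff_of_false ((mem_iff_conjugate_notMem (Φ i₁) _).1 hΦy) hny
  -- the four types of `K_{i₁}` through the memberships of `c`, `d`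
  rcases mem_or_conjugate_mem (Φ i₁) c with hΦc | hΦc' <;> rcases mem_or_conjugate_mem (Φ i₁) d with hΦd | hΦd'
  · -- `{c, d}`: equivalent to `Φ_{i₀}` along `e`
    exfalso
    refine hpull e c d hdc hdc' (fun s => ?_) (by rw [hcea]; exact hΦa) (by rw [hdeb]; exact hΦb)
    have hnc := (mem_iff_conjugate_notMem (Φ i₁) c).1 hΦc
    have hnd := (mem_iff_conjugate_notMem (Φ i₁) d).1 hΦd
    rcases QuarticCM.eq_or_eq_or_eq_or_eq h4₁ hdc hdc' s with rfl | rfl | rfl | rfl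
    · exact iff_of_true hΦc (Or.inl rfl)
    · exact iff_of_false hnc (by rintro (h | h); exacts [QuarticCM.conjugate_ne c h, hdc' h.symm])
    · exact iff_of_true hΦd (Or.inr rfl)
    · refine iff_of_false hnd ?_
      rintro (h | h)
      · exact hdc' (by rw [← involutive_conjugate (K i₁) d, h])
      · exact QuarticCM.conjugate_ne d h
  · -- `{c, d̄}`: the fixed-point core
    refine isNondegenerateFamily_pair_of_reflection_fixed h01 hI h4₀ h4₁ hba hba' hτa hτb hτ₀a hτ₀b hτc (g2 c) hτ₀c
      hΦ₀ fun s => ?_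
    have hnc := (mem_iff_conjugate_notMem (Φ i₁) c).1 hΦc
    have hnd : d ∉ (Φ i₁).1 := fun h => (mem_iff_conjugate_notMem (Φ i₁) d).1 h hΦd'
    rcases QuarticCM.eq_or_eq_or_eq_or_eq h4₁ hdc hdc' s with rfl | rfl | rfl | rfl
    · exact iff_of_true hΦc (Or.inl rfl)
    · refine iff_of_false hnc ?_
      rintro (h | h)
      · exact QuarticCM.conjugate_ne c h
      · exact hdc ((involutive_conjugate (K i₁)).injective h).symm
    · refine iff_of_false hnd ?_
      rintro (h | h)
      · exact hdc h
      · exact QuarticCM.conjugate_ne d h.symm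
    · exact iff_of_true hΦd' (Or.inr rfl)
  · -- `{c̄, d}`: the fixed-point core for `c̄` (`τ c̄ = d̄`, `\overline{τ c̄} = d`)
    have hτcc : τ • conjugate c = conjugate d := by rw [QuarticCM.smul_conjugate]
    have hτ₀cc : τ₀ • conjugate c = conjugate c := by rw [QuarticCM.smul_conjugate, hτ₀c]
    refine isNondegenerateFamily_pair_of_reflection_fixed h01 hI h4₀ h4₁ hba hba' hτa hτb hτ₀a hτ₀b (g1 _) (g2 _)
      hτ₀cc hΦ₀ fun s => ?_
    rw [hτcc, involutive_conjugate (K i₁) d]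
    have hnc : c ∉ (Φ i₁).1 := fun h => (mem_iff_conjugate_notMem (Φ i₁) c).1 h hΦc'
    have hnd := (mem_iff_conjugate_notMem (Φ i₁) d).1 hΦd
    rcases QuarticCM.eq_or_eq_or_eq_or_eq h4₁ hdc hdc' s with rfl | rfl | rfl | rfl
    · refine iff_of_false hnc ?_
      rintro (h | h)
      · exact QuarticCM.conjugate_ne c h.symm
      · exact hdc h.symm
    · exact iff_of_true hΦc' (Or.inl rfl)
    · exact iff_of_true hΦd (Or.inr rfl)
    · refine iff_of_false hnd ?_
      rintro (h | h)
      · exact hdc ((involutive_conjugate (K i₁)).injective h)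
      · exact QuarticCM.conjugate_ne d h
  · -- `{c̄, d̄}`: equivalent to `Φ̄_{i₀}` along `ρ e`
    exfalso
    let e' : K i₀ ≃+* K i₁ := (conjGal : K i₀ ≃ₐ[ℚ] K i₀).toRingEquiv.trans e
    have hcomp : ∀ u : K i₁ →+* ℂ, u.comp e'.toRingHom = conjugate (u.comp e.toRingHom) := fun u => by
      rw [CyclicSextic.conjugate_eq_comp_conjGal]
      rfl
    have hcd : conjugate d ≠ conjugate c := fun h => hdc ((involutive_conjugate (K i₁)).injective h)
    have hcd' : conjugate d ≠ conjugate (conjugate c) := by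
      rw [involutive_conjugate (K i₁) c]; exact fun h => hdc' ((involutive_conjugate (K i₁)).injective
        (by rw [involutive_conjugate (K i₁) c]; exact h))
    refine hpull e' (conjugate c) (conjugate d) hcd hcd' (fun s => ?_)
      (by rw [hcomp, conjugate_comp, hcea, involutive_conjugate (K i₀) a]; exact hΦa)
      (by rw [hcomp, conjugate_comp, hdeb, involutive_conjugate (K i₀) b]; exact hΦb)
    have hnc : c ∉ (Φ i₁).1 := fun h => (mem_iff_conjugate_notMem (Φ i₁) c).1 h hΦc'
    have hnd : d ∉ (Φ i₁).1 := fun h => (mem_iff_conjugate_notMem (Φ i₁) d).1 h hΦd'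
    rcases QuarticCM.eq_or_eq_or_eq_or_eq h4₁ hdc hdc' s with rfl | rfl | rfl | rfl
    · refine iff_of_false hnc ?_
      rintro (h | h)
      · exact QuarticCM.conjugate_ne c h.symm
      · exact hdc' (by rw [h, involutive_conjugate (K i₁) d])
    · exact iff_of_true hΦc' (Or.inl rfl)
    · refine iff_of_false hnd ?_
      rintro (h | h)
      · exact hdc' h
      · exact QuarticCM.conjugate_ne d h.symm
    · exact iff_of_true hΦd' (Or.inr rfl)

end Dress

/-! ### The synthesis -/

section Geometry

variable {I : Type} {K : I → Type} [∀ i, Field (K i)] [∀ i, NumberField (K i)] [∀ i, IsCMField (K i)] [Fintype I]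
  [Nonempty I] {Φ : ∀ i, CMType (K i)}
variable {A : I → AbelianVariety ℂ} {ι : ∀ i, 𝓞 (K i) →+* End (A i)}
  {θ : ∀ i, K i →+* Module.End ℂ (complexBetti (A i).X 1)}

/-- **Two simple, non-isogenous CM abelian surfaces, `K_{i₀}` a NON-GALOIS quartic CM field, `K_{i₁}` any quartic CM
field: the family is nondegenerate** (separating by simplicity and non-isogeny; `K_{i₁} ≇ K_{i₀}`: different or equal
closures; `K_{i₁} ≅ K_{i₀}`: the fixed-point core). [cite: MoonenZarhin1999LowDim, "Hodge groups of simple abelian surfaces of CM-type" and Cor. (3.9)] -/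
theorem isNondegenerateFamily_simpleSurfaces_of_not_isGalois {i₀ i₁ : I} (h01 : i₀ ≠ i₁)
    (hI : ∀ j, j = i₀ ∨ j = i₁) (h4 : ∀ i, finrank ℚ (K i) = 4) (hK₀ : ¬ IsGalois ℚ (K i₀))
    (hA : ∀ i, IsCMTypeRealisation (Φ i) (A i) (ι i) (θ i)) (hS : ∀ i, (A i).IsSimple)
    (hniso : ∀ i j, i ≠ j → ¬ AbelianVariety.IsIsogenous (A i) (A j)) : CMAlgebra.IsNondegenerateFamily Φ := by
  have hsep : CMAlgebra.IsSeparatingFamily Φ :=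
    CMAlgebra.isSeparatingFamily_of_isSimple_of_pairwise_not_isIsogenous hA hS hniso
  by_cases hKK : Nonempty (K i₀ ≃+* K i₁)
  · obtain ⟨e⟩ := hKK
    exact isNondegenerateFamily_of_ringEquiv_of_isSeparatingFamily h01 hI (h4 i₀) hK₀ (h4 i₁) e hsep
  · rw [not_nonempty_iff] at hKK
    by_cases hL : normalClosure ℚ (K i₀) ℂ = normalClosure ℚ (K i₁) ℂ
    · exact isNondegenerateFamily_pair_of_normalClosure_eq_of_isEmpty h01 hI (h4 i₀) (h4 i₁) hL hKK Φ
    · have hreal : ∀ x : ℂ, x ∈ normalClosure ℚ (K i₀) ℂ → x ∈ normalClosure ℚ (K i₁) ℂ → starRingEnd ℂ x = x :=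
        fun x hx₀ hx₁ => conj_apply_eq_of_mem_inf_of_normalClosure_ne (h4 i₀) (h4 i₁)
          (not_biquadratic_of_isPrimitive i₀ (h4 i₀)
            ((isSimple_iff_isPrimitive (hA i₀) (Classical.arbitrary (K i₀ →+* ℂ))).1 (hS i₀)))
          (not_biquadratic_of_isPrimitive i₁ (h4 i₁)
            ((isSimple_iff_isPrimitive (hA i₁) (Classical.arbitrary (K i₁ →+* ℂ))).1 (hS i₁))) hL hx₀ hx₁
      refine (isNondegenerateFamily_iff_of_partialConj (forall_exists_partialConj_pair h01 hI hreal) Φ).2 fun i => ?_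
      exact QuarticCM.isNondegenerate_of_isPrimitive (h4 i) (Φ i)
        ((isSimple_iff_isPrimitive (hA i) (Classical.arbitrary (K i →+* ℂ))).1 (hS i))

end Geometry

end Literature.AlgebraicGeometry.ComplexMultiplication

end

/-! ## Part 2: TwoSimpleCMSurfacesHodge -/

noncomputable section

open _root_.CategoryTheory _root_.CategoryTheory.Limits NumberField NumberField.ComplexEmbedding IntermediateField Module

namespace Literature.AlgebraicGeometry.ComplexMultiplication

open Literature.AlgebraicGeometry.ComplexMultiplication.Domination Literature.AlgebraicGeometry.ComplexMultiplication.RealIntersectionCMFieldsHodge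

open Literature.NumberTheory.ComplexMultiplication
open Literature.NumberTheory.ComplexMultiplication.CMTypeOps (mem_iff_conjugate_notMem)
open Literature.AlgebraicGeometry.Motives (AbelianVariety CMType)
open Literature.AlgebraicGeometry.HodgeTheory
open Literature.AlgebraicGeometry.ComplexMultiplication (IsCMTypeRealisation isSimple_iff_isPrimitive)
open Literature.AlgebraicGeometry.Pohlmann1968

/-! ### The unique involution of a cyclic group of order `4` -/

section Cyclic

variable {G : Type*} [Group G] [Finite G] [IsCyclic G]

/-- In a cyclic group of order `4` the elements of square `1` are `1` and the unique involution `ρ`. [cite: Gordon1999HodgeAVSurvey, 7.4] -/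
private theorem eq_one_or_eq_of_mul_self_eq_one (hG : Nat.card G = 4) {ρ : G} (hρ1 : ρ ≠ 1) (hρ2 : ρ * ρ = 1)
    {k : G} (hk : k * k = 1) : k = 1 ∨ k = ρ := by
  obtain ⟨γ, hγ⟩ := IsCyclic.exists_generator (α := G)
  have hoγ : orderOf γ = 4 := (orderOf_eq_card_of_forall_mem_zpowers hγ).trans hG
  have key : ∀ k : G, k * k = 1 → k = 1 ∨ k = γ ^ 2 := by
    intro k hk
    obtain ⟨n, rfl⟩ := (Submonoid.mem_powers_iff _ _).1 (mem_powers_iff_mem_zpowers.2 (hγ k))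
    have hdvd : 4 ∣ n + n := by
      rw [← hoγ]
      exact orderOf_dvd_of_pow_eq_one (by rw [pow_add]; exact hk)
    have hmod : n % 4 = 0 ∨ n % 4 = 2 := by omega
    rw [← pow_mod_orderOf, hoγ]
    rcases hmod with h | h
    · left; rw [h, pow_zero]
    · right; rw [h]
  rcases key ρ hρ2 with h | h
  · exact absurd h hρ1
  · rw [h]; exact key k hk

/-- In a cyclic group of order `4` with involution `ρ`, every `k ∉ {1, ρ}` has `k² = ρ`. [cite: Gordon1999HodgeAVSurvey, 7.4] -/
private theorem mul_self_eq_of_ne (hG : Nat.card G = 4) {ρ : G} (hρ1 : ρ ≠ 1) (hρ2 : ρ * ρ = 1) {k : G}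
    (hk1 : k ≠ 1) (hkρ : k ≠ ρ) : k * k = ρ := by
  have h4 : (k * k) * (k * k) = 1 := by
    have hk4 : k ^ Nat.card G = 1 := pow_card_eq_one'
    rw [hG] at hk4
    simpa [pow_succ, mul_assoc] using hk4
  rcases eq_one_or_eq_of_mul_self_eq_one hG hρ1 hρ2 h4 with h | h
  · rcases eq_one_or_eq_of_mul_self_eq_one hG hρ1 hρ2 h with h' | h'
    · exact absurd h' hk1
    · exact absurd h' hkρ
  · exact h

end Cyclic

/-! ### Isomorphic cyclic quartic CM fields carry no separating pair -/

section Fields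

variable {I : Type} {K : I → Type} [∀ i, Field (K i)] [∀ i, NumberField (K i)] [∀ i, IsCMField (K i)] [Fintype I]

omit [∀ i, NumberField (K i)] [Fintype I] in
/-- `ū ∘ e = \overline{u ∘ e}`. [cite: Gordon1999HodgeAVSurvey, 7.4] -/
private theorem conjugate_comp' {i₀ i₁ : I} (u : K i₁ →+* ℂ) (e : K i₀ →+* K i₁) :
    (conjugate u).comp e = conjugate (u.comp e) :=
  RingHom.ext fun x => by rw [RingHom.comp_apply, conjugate_coe_eq, conjugate_coe_eq, RingHom.comp_apply]

omit [Fintype I] in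
/-- A separating family has no slot whose type, pulled back along a field isomorphism `e'`, is the type of another
slot: if `Φ_{i₁} = {x, y}` and `x ∘ e', y ∘ e' ∈ Φ_{i₀}` then `i₀ = i₁`. [cite: Gordon1999HodgeAVSurvey, 7.4] -/
private theorem false_of_pullback {i₀ i₁ : I} (h01 : i₀ ≠ i₁) (h4₁ : finrank ℚ (K i₁) = 4) {Φ : ∀ i, CMType (K i)}
    (hsep : CMAlgebra.IsSeparatingFamily Φ) (e' : K i₀ ≃+* K i₁) {x y : K i₁ →+* ℂ} (hyx : y ≠ x)
    (hyx' : y ≠ conjugate x) (hΦ₁ : ∀ s, s ∈ (Φ i₁).1 ↔ s = x ∨ s = y) (hx : x.comp e'.toRingHom ∈ (Φ i₀).1)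
    (hy : y.comp e'.toRingHom ∈ (Φ i₀).1) : False := by
  refine h01 (hsep.eq_of_forall_mem_iff_comp_mem e' fun u => ?_)
  have hnx : (conjugate x).comp e'.toRingHom ∉ (Φ i₀).1 := by
    rw [conjugate_comp']; exact (mem_iff_conjugate_notMem (Φ i₀) _).1 hx
  have hny : (conjugate y).comp e'.toRingHom ∉ (Φ i₀).1 := by
    rw [conjugate_comp']; exact (mem_iff_conjugate_notMem (Φ i₀) _).1 hy
  have hΦx : x ∈ (Φ i₁).1 := (hΦ₁ x).2 (Or.inl rfl)
  have hΦy : y ∈ (Φ i₁).1 := (hΦ₁ y).2 (Or.inr rfl)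
  rcases QuarticCM.eq_or_eq_or_eq_or_eq h4₁ hyx hyx' u with rfl | rfl | rfl | rfl
  · exact iff_of_true hΦx hx
  · exact iff_of_false ((mem_iff_conjugate_notMem (Φ i₁) _).1 hΦx) hnx
  · exact iff_of_true hΦy hy
  · exact iff_of_false ((mem_iff_conjugate_notMem (Φ i₁) _).1 hΦy) hny

omit [Fintype I] in
/-- **Isomorphic CYCLIC quartic CM fields carry no separating pair of CM types** (two simple CM abelian surfaces with
isomorphic cyclic quartic CM fields are isogenous): in `Gal(K/ℚ) ≅ C₄` the unique involution is `ρ`; writing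
`Φ_{i₀} = {a, a∘g}` and the type of `K_{i₁}` pulled back along `e` as `{x, x∘h}` with `x = a∘δ`, one has `g² = h² = ρ`,
so `h = g` or `h = ρg`, and the type of `K_{i₁}` is CM-equivalent to `Φ_{i₀}` along `e∘δ⁻¹` resp. `e∘δ⁻¹∘g`.
[cite: Shimura1998, §8.4 Example (2)(B)] [cite: Gordon1999HodgeAVSurvey, 7.4] -/
theorem false_of_isCyclic_of_ringEquiv_of_isSeparatingFamily {i₀ i₁ : I} (h01 : i₀ ≠ i₁) [IsGalois ℚ (K i₀)]
    [IsCyclic (K i₀ ≃ₐ[ℚ] K i₀)] (h4₀ : finrank ℚ (K i₀) = 4) (h4₁ : finrank ℚ (K i₁) = 4) (e : K i₀ ≃+* K i₁)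
    {Φ : ∀ i, CMType (K i)} (hsep : CMAlgebra.IsSeparatingFamily Φ) : False := by
  classical
  -- the Galois group: cyclic of order `4`, `ρ` its involution
  have hcard : Nat.card (K i₀ ≃ₐ[ℚ] K i₀) = 4 := by rw [IsGalois.card_aut_eq_finrank, h4₀]
  set ρ : K i₀ ≃ₐ[ℚ] K i₀ := conjGal with hρ
  have hρρ : ρ * ρ = 1 := conjGal_mul_conjGal
  have hcomm : ∀ p q : K i₀ ≃ₐ[ℚ] K i₀, p * q = q * p := fun p q =>
    (IsCyclic.isMulCommutative (α := K i₀ ≃ₐ[ℚ] K i₀)).is_comm.comm p q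
  have hρv : ∀ (v : K i₀ →+* ℂ) (z : K i₀), v (ρ z) = conjugate v z := fun v z => by
    rw [CyclicSextic.conjugate_eq_comp_conjGal]; rfl
  -- slot `i₀`: `Φ_{i₀} = {a, b}`, `b = a ∘ g`
  obtain ⟨a, b, hba, hba', hΦ₀⟩ := QuarticCM.exists_mem_mem_ne h4₀ (Φ i₀)
  have hρ1 : ρ ≠ 1 := by
    intro h
    apply QuarticCM.conjugate_ne a
    refine RingHom.ext fun z => ?_
    rw [← hρv, h, AlgEquiv.one_apply]
  obtain ⟨g, hg⟩ := exists_comp_algEquiv_eq a b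
  have pg : ∀ z, a (g z) = b z := fun z => by simpa using RingHom.congr_fun hg z
  have hg1 : g ≠ 1 := by
    rintro rfl; exact hba (RingHom.ext fun z => by rw [← pg]; rfl)
  have hgρ : g ≠ ρ := by
    rintro h; exact hba' (RingHom.ext fun z => by rw [← pg, h, hρv])
  have hgg : g * g = ρ := mul_self_eq_of_ne hcard hρ1 hρρ hg1 hgρ
  -- slot `i₁`, pulled back along `e`: `{x, y}`, `x = a ∘ δ`, `y = x ∘ h`
  obtain ⟨c', d', hdc, hdc', hΦ₁⟩ := QuarticCM.exists_mem_mem_ne h4₁ (Φ i₁)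
  set x : K i₀ →+* ℂ := c'.comp e.toRingHom with hx
  set y : K i₀ →+* ℂ := d'.comp e.toRingHom with hy
  have hinj : ∀ u u' : K i₁ →+* ℂ, u.comp e.toRingHom = u'.comp e.toRingHom → u = u' := fun u u' h =>
    RingHom.ext fun w => by simpa using RingHom.congr_fun h (e.symm w)
  have hyx : y ≠ x := fun h => hdc (hinj _ _ h)
  have hyx' : y ≠ conjugate x := fun h => hdc' (hinj _ _ (by rw [conjugate_comp']; exact h))
  obtain ⟨δ, hδ⟩ := exists_comp_algEquiv_eq a x
  obtain ⟨h, hh⟩ := exists_comp_algEquiv_eq x y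
  have pδ : ∀ z, a (δ z) = x z := fun z => by simpa using RingHom.congr_fun hδ z
  have ph : ∀ z, x (h z) = y z := fun z => by simpa using RingHom.congr_fun hh z
  have hh1 : h ≠ 1 := by
    rintro rfl; exact hyx (RingHom.ext fun z => by rw [← ph]; rfl)
  have hhρ : h ≠ ρ := by
    rintro h'; exact hyx' (RingHom.ext fun z => by rw [← ph, h', hρv])
  have hhh : h * h = ρ := mul_self_eq_of_ne hcard hρ1 hρρ hh1 hhρ
  -- `h = g` or `h = ρ g`
  have hsq : (h * g⁻¹) * (h * g⁻¹) = 1 := by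
    rw [mul_assoc, ← mul_assoc g⁻¹, hcomm g⁻¹ h, mul_assoc, ← mul_assoc, hhh, ← mul_inv_rev, hgg, mul_inv_cancel]
  have px : ∀ z, x z = c' (e z) := fun z => rfl
  have py : ∀ z, y z = d' (e z) := fun z => rfl
  have pcomm : ∀ (p q : K i₀ ≃ₐ[ℚ] K i₀) (z : K i₀), p (q z) = q (p z) := fun p q z => by
    rw [← AlgEquiv.mul_apply, hcomm, AlgEquiv.mul_apply]
  rcases eq_one_or_eq_of_mul_self_eq_one hcard hρ1 hρρ hsq with h1 | h2
  · -- `h = g`: the type of `K_{i₁}` is `Φ_{i₀}` along `e ∘ δ⁻¹`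
    have hhg : h = g := mul_inv_eq_one.1 h1
    let e' : K i₀ ≃+* K i₁ := δ.symm.toRingEquiv.trans e
    refine false_of_pullback h01 h4₁ hsep e' hdc hdc' hΦ₁ ?_ ?_
    · have : c'.comp e'.toRingHom = a := RingHom.ext fun z => by
        show c' (e (δ.symm z)) = a z
        rw [← px, ← pδ, AlgEquiv.apply_symm_apply]
      rw [this]; exact (hΦ₀ a).2 (Or.inl rfl)
    · have : d'.comp e'.toRingHom = b := RingHom.ext fun z => by
        show d' (e (δ.symm z)) = b z
        rw [← py, ← ph, hhg, pcomm g δ.symm, ← pδ, AlgEquiv.apply_symm_apply, pg]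
      rw [this]; exact (hΦ₀ b).2 (Or.inr rfl)
  · -- `h = ρ g`: the type of `K_{i₁}` is `Φ_{i₀}` along `e ∘ δ⁻¹ ∘ g`
    have hhg : h = ρ * g := mul_inv_eq_iff_eq_mul.1 h2
    let e' : K i₀ ≃+* K i₁ := (g.trans δ.symm).toRingEquiv.trans e
    refine false_of_pullback h01 h4₁ hsep e' hdc hdc' hΦ₁ ?_ ?_
    · have : c'.comp e'.toRingHom = b := RingHom.ext fun z => by
        show c' (e (δ.symm (g z))) = b z
        rw [← px, ← pδ, AlgEquiv.apply_symm_apply, pg]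
      rw [this]; exact (hΦ₀ b).2 (Or.inr rfl)
    · have hgg' : ∀ z, g (g z) = ρ z := fun z => by rw [← AlgEquiv.mul_apply, hgg]
      have hρρ' : ∀ z, ρ (ρ z) = z := fun z => by rw [← AlgEquiv.mul_apply, hρρ, AlgEquiv.one_apply]
      have : d'.comp e'.toRingHom = a := RingHom.ext fun z => by
        show d' (e (δ.symm (g z))) = a z
        rw [← py, ← ph, hhg, AlgEquiv.mul_apply, pcomm g δ.symm, hgg', pcomm ρ δ.symm, hρρ', ← pδ,
          AlgEquiv.apply_symm_apply]
      rw [this]; exact (hΦ₀ a).2 (Or.inl rfl)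

end Fields

/-! ### The synthesis: any two simple, non-isogenous CM abelian surfaces -/

section Geometry

variable {I : Type} {K : I → Type} [∀ i, Field (K i)] [∀ i, NumberField (K i)] [∀ i, IsCMField (K i)] [Fintype I]
  [Nonempty I] {Φ : ∀ i, CMType (K i)}
variable {A : I → AbelianVariety ℂ} {ι : ∀ i, 𝓞 (K i) →+* End (A i)}
  {θ : ∀ i, K i →+* Module.End ℂ (complexBetti (A i).X 1)}

/-- **Any two simple, non-isogenous CM abelian surfaces form a NONDEGENERATE pair** (Moonen–Zarhin:
`Hg(S₀ × S₁) = Hg(S₀) × Hg(S₁)`, rank `5`): realisations `S_i` of CM types `Φ_i` of quartic CM fields `K_i`, `S_i` simple,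
`S₀ ≁ S₁` — no hypothesis on the fields.  Cases: `K_{i₀}` not Galois (`NonIsogenousSimpleCMSurfacesHodge`); `K_{i₀}`
cyclic and `K_{i₁} ≇ K_{i₀}` (different closures, or the reflex-pair theorem); `K_{i₀}` cyclic and `K_{i₁} ≅ K_{i₀}`:
impossible for a separating pair. [cite: MoonenZarhin1999LowDim, "Hodge groups of simple abelian surfaces of CM-type"] -/
theorem isNondegenerateFamily_simpleSurfaces {i₀ i₁ : I} (h01 : i₀ ≠ i₁) (hI : ∀ j, j = i₀ ∨ j = i₁)
    (h4 : ∀ i, finrank ℚ (K i) = 4) (hA : ∀ i, IsCMTypeRealisation (Φ i) (A i) (ι i) (θ i))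
    (hS : ∀ i, (A i).IsSimple) (hniso : ∀ i j, i ≠ j → ¬ AbelianVariety.IsIsogenous (A i) (A j)) :
    CMAlgebra.IsNondegenerateFamily Φ := by
  by_cases hK₀ : IsGalois ℚ (K i₀)
  · have hsep : CMAlgebra.IsSeparatingFamily Φ :=
      CMAlgebra.isSeparatingFamily_of_isSimple_of_pairwise_not_isIsogenous hA hS hniso
    haveI : IsCyclic (K i₀ ≃ₐ[ℚ] K i₀) := QuarticCM.isCyclic_of_isPrimitive (h4 i₀)
      ((isSimple_iff_isPrimitive (hA i₀) (Classical.arbitrary (K i₀ →+* ℂ))).1 (hS i₀))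
    by_cases hKK : Nonempty (K i₀ ≃+* K i₁)
    · obtain ⟨e⟩ := hKK
      exact (false_of_isCyclic_of_ringEquiv_of_isSeparatingFamily h01 (h4 i₀) (h4 i₁) e hsep).elim
    · rw [not_nonempty_iff] at hKK
      by_cases hL : normalClosure ℚ (K i₀) ℂ = normalClosure ℚ (K i₁) ℂ
      · exact isNondegenerateFamily_pair_of_normalClosure_eq_of_isEmpty h01 hI (h4 i₀) (h4 i₁) hL hKK Φ
      · have hreal : ∀ x : ℂ, x ∈ normalClosure ℚ (K i₀) ℂ → x ∈ normalClosure ℚ (K i₁) ℂ →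
            starRingEnd ℂ x = x :=
          fun x hx₀ hx₁ => conj_apply_eq_of_mem_inf_of_normalClosure_ne (h4 i₀) (h4 i₁)
            (not_biquadratic_of_isPrimitive i₀ (h4 i₀)
              ((isSimple_iff_isPrimitive (hA i₀) (Classical.arbitrary (K i₀ →+* ℂ))).1 (hS i₀)))
            (not_biquadratic_of_isPrimitive i₁ (h4 i₁)
              ((isSimple_iff_isPrimitive (hA i₁) (Classical.arbitrary (K i₁ →+* ℂ))).1 (hS i₁))) hL hx₀ hx₁
        refine (isNondegenerateFamily_iff_of_partialConj (forall_exists_partialConj_pair h01 hI hreal) Φ).2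
          fun i => ?_
        exact QuarticCM.isNondegenerate_of_isPrimitive (h4 i) (Φ i)
          ((isSimple_iff_isPrimitive (hA i) (Classical.arbitrary (K i →+* ℂ))).1 (hS i))
  · exact isNondegenerateFamily_simpleSurfaces_of_not_isGalois h01 hI h4 hK₀ hA hS hniso

end Geometry

end Literature.AlgebraicGeometry.ComplexMultiplication

end
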